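import Summits.Schanuel.Schanuel.Theorems.DiophantineDichotomyApproximationPropertySmallPrimeHypersurface

/-!
# Stub `exists_primeFactor_mem` of line `orbit-interpolation-determinant` (crux `ApproximationProperty`, stmt-Schanuel-6117)

Route `DiophantineDichotomy` (sub-problem `Schanuel/Schanuel`), crux
`Summit.Schanuel.Schanuel.Theses.DiophantineDichotomy.ApproximationProperty` (stmt-Schanuel-6117),
line `orbit-interpolation-determinant`, skeleton v24, registered support stub
`exists_primeFactor_mem`: **a non-zero form `F` of degree `d` of `ℚ[x₀, …, x₃]` lying in a prime
ideal `𝔮'` has an irreducible factor `Q₂ ∈ 𝔮'`**, a form of some degree `a₂` with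
`1 ≤ a₂ ≤ d`, generating a prime principal ideal `(Q₂)`, with `Q₂ ∣ F`.

Proof: `ℚ[x₀, …, x₃]` is factorial, so `F` is a unit times the product of its prime factors
(`UniqueFactorizationMonoid.factors_prod`); the product lies in the prime `𝔮'`, hence so does
one prime factor `Q₂` (`Ideal.IsPrime.multiset_prod_mem_iff_exists_mem`). A divisor of a
non-zero form is a form (`Roy2013.isHomogeneous_of_dvd`) of degree `a₂ = deg Q₂ ≤ deg F = d`
(`MvPolynomial.totalDegree_le_of_dvd_of_isDomain`), `a₂ ≥ 1` because the polynomials of total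
degree `0` are the constants, which are `0` or units, and `(Q₂)` is prime
(`Ideal.span_singleton_prime`).

Proofs only: no definitions, nothing asserted beyond the registered stub and two folklore
helpers. Sources: folklore (Gauss: polynomial rings over a field are factorial).
-/

set_option linter.dupNamespace false

noncomputable section

namespace Summit.Schanuel.Schanuel.Cruxes.ApproximationProperty.OrbitInterpolationDeterminant

open Literature.NumberTheory.Transcendental Literature.NumberTheory.Transcendental.Nesterenko
open MvPolynomial

namespace ExistsPrimeFactorMem

/-- In the factorial ring `ℚ[x₀, …, x_m]` a non-zero element `F` of a prime ideal `𝔮'` has a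
prime factor in `𝔮'`. [folklore] -/
theorem exists_prime_dvd_mem {m : ℕ} {F : Rx m} (hF0 : F ≠ 0) {𝔮' : Ideal (Rx m)}
    (h𝔮' : 𝔮'.IsPrime) (hF : F ∈ 𝔮') : ∃ p : Rx m, Prime p ∧ p ∣ F ∧ p ∈ 𝔮' := by
  classical
  obtain ⟨u, hu⟩ := UniqueFactorizationMonoid.factors_prod hF0
  have hprod : (UniqueFactorizationMonoid.factors F).prod ∈ 𝔮' := by
    rw [← hu, Ideal.mul_unit_mem_iff_mem _ u.isUnit] at hF
    exact hF
  obtain ⟨p, hp, hp𝔮⟩ := (h𝔮'.multiset_prod_mem_iff_exists_mem _).1 hprod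
  exact ⟨p, UniqueFactorizationMonoid.prime_of_factor p hp,
    UniqueFactorizationMonoid.dvd_of_mem_factors hp, hp𝔮⟩

/-- A prime element of `ℚ[x₀, …, x_m]` has positive total degree: a polynomial of total degree
`0` is a constant, and a non-zero constant is a unit. [folklore] -/
theorem one_le_totalDegree_of_prime {m : ℕ} {p : Rx m} (hp : Prime p) : 1 ≤ p.totalDegree := by
  rcases Nat.eq_zero_or_pos p.totalDegree with h0 | h0
  · exfalso
    have hpC : p = C (p.coeff 0) := totalDegree_eq_zero_iff_eq_C.mp h0
    have hc : p.coeff 0 ≠ 0 := fun hc => hp.ne_zero (by rw [hpC, hc, C_0])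
    exact hp.not_unit (hpC ▸ (isUnit_iff_ne_zero.mpr hc).map C)
  · exact h0

end ExistsPrimeFactorMem

/-! ## The stub -/

/-- **Registered stub `exists_primeFactor_mem`**: a non-zero form `F` of degree `d` of
`ℚ[x₀, …, x₃]` lying in a prime ideal `𝔮'` has an irreducible factor `Q₂ ∈ 𝔮'`: `Q₂ ≠ 0` is a
form of some degree `a₂` with `1 ≤ a₂ ≤ d`, `(Q₂)` is prime and `Q₂ ∣ F` (unique factorisation
in `ℚ[x₀, …, x₃]`, one prime factor of `F ∈ 𝔮'` lies in the prime `𝔮'`, divisors of forms are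
forms, and non-zero constants are units). [folklore] -/
theorem exists_primeFactor_mem : ∀ (F : Rx 3) (d : ℕ) (𝔮' : Ideal (Rx 3)), F ≠ 0 → F.IsHomogeneous d → 𝔮'.IsPrime → F ∈ 𝔮' → ∃ (Q₂ : Rx 3) (a₂ : ℕ), Q₂ ≠ 0 ∧ Q₂.IsHomogeneous a₂ ∧ 1 ≤ a₂ ∧ a₂ ≤ d ∧ (Ideal.span {Q₂}).IsPrime ∧ Q₂ ∣ F ∧ Q₂ ∈ 𝔮' := by
  intro F d 𝔮' hF0 hF h𝔮' hF𝔮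
  obtain ⟨p, hp, hpF, hp𝔮⟩ := ExistsPrimeFactorMem.exists_prime_dvd_mem hF0 h𝔮' hF𝔮
  have hp0 : p ≠ 0 := hp.ne_zero
  refine ⟨p, p.totalDegree, hp0, Roy2013.isHomogeneous_of_dvd hF hF0 hpF,
    ExistsPrimeFactorMem.one_le_totalDegree_of_prime hp, ?_,
    (Ideal.span_singleton_prime hp0).mpr hp, hpF, hp𝔮⟩
  rw [← hF.totalDegree hF0]
  exact totalDegree_le_of_dvd_of_isDomain hpF hF0

end Summit.Schanuel.Schanuel.Cruxes.ApproximationProperty.OrbitInterpolationDeterminant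

end
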